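import Summits.QuantumAdvantage.QuantumAdvantage.Theses.DarkClassGroups
import Summits.QuantumAdvantage.QuantumAdvantage.Theses.Shor
import Summits.QuantumAdvantage.QuantumAdvantage.Theorems.LinnikCubicClassGroupsBitwiseSearchToDecision

/-!
# QuantumAdvantage — the shared support `SearchToDecision` (stmt-QuantumAdvantage-0235)

Routes `DarkClassGroups` (`SearchToDecision`) and `Shor` (`ShorSearchToDecision`) carry the same
item stmt-QuantumAdvantage-0235: *bitwise search-to-decision under the collapse `BQP ⊆ BPP`* —
if `f` has exactly polynomial output length and `f ∈ FBQP`, then under `BQP ⊆ BPP` some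
probabilistic polynomial-time algorithm `A` outputs `f x` with probability `≥ 2/3` on every `x`.

Route `LinnikCubicClassGroups` states the identical proposition with the abbreviation
`IsPPT A id` unfolded to `A.IsPolyTime id id` (`Literature.Computability.Cryptography.IsPPT` is
BY DEFINITION `fun A T => A.IsPolyTime id T`, so the two spellings are definitionally equal), and
that version is PROVED in the tree:
`Summit.QuantumAdvantage.QuantumAdvantage.Theorems.LinnikCubicClassGroups.BitwiseSearchToDecision_proof`
(Theorems/LinnikCubicClassGroupsBitwiseSearchToDecision.lean; bit languages in `BQP` by the
classical wrap, then the tree's pseudo-deterministic simulation of bounded adaptive reductions to a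
`BPP` language). This file closes the shared item for both route decls by that proof, verbatim.

HONEST FRAMING (block-2b rule): the value here is a closed ledger item (a theorem), not summit
progress.
-/

set_option linter.dupNamespace false -- D-0017: single-problem summit ⇒ `QuantumAdvantage.QuantumAdvantage` by design

namespace Summit.QuantumAdvantage.QuantumAdvantage.Theorems.SearchToDecision

/-- **`DarkClassGroups.SearchToDecision`** (stmt-QuantumAdvantage-0235): bitwise search-to-decision
under `BQP ⊆ BPP`. The route decl is definitionally the proved
`LinnikCubicClassGroups.BitwiseSearchToDecision` (`IsPPT A id` unfolds to `A.IsPolyTime id id`).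
[Aaronson 2010, §1; Bernstein–Vazirani 1997, §8; Arora–Barak 2009, §7.4.1] [folklore] -/
theorem searchToDecision_proof :
    Summit.QuantumAdvantage.QuantumAdvantage.Theses.DarkClassGroups.SearchToDecision := by
  unfold Summit.QuantumAdvantage.QuantumAdvantage.Theses.DarkClassGroups.SearchToDecision
  exact Summit.QuantumAdvantage.QuantumAdvantage.Theorems.LinnikCubicClassGroups.BitwiseSearchToDecision_proof

/-- **`Shor.ShorSearchToDecision`** (the same shared item stmt-QuantumAdvantage-0235 as rendered in
route `Shor`): bitwise search-to-decision under `BQP ⊆ BPP`, again definitionally the proved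
`LinnikCubicClassGroups.BitwiseSearchToDecision`.
[Aaronson 2010, §1; Bernstein–Vazirani 1997, §8; Arora–Barak 2009, §7.4.1] [folklore] -/
theorem shorSearchToDecision_proof :
    Summit.QuantumAdvantage.QuantumAdvantage.Theses.Shor.ShorSearchToDecision := by
  unfold Summit.QuantumAdvantage.QuantumAdvantage.Theses.Shor.ShorSearchToDecision
  exact Summit.QuantumAdvantage.QuantumAdvantage.Theorems.LinnikCubicClassGroups.BitwiseSearchToDecision_proof

end Summit.QuantumAdvantage.QuantumAdvantage.Theorems.SearchToDecision
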